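import Literature.AnabelianGeometry.SemiGraphs.TemperedSpecialFibreCuspExtension
import Literature.AnabelianGeometry.SemiGraphs.TemperedSpecialFibreTowerPiDataInduces
import Literature.AnabelianGeometry.SemiGraphs.TemperedCompactInVerticialFinite
import Literature.AnabelianGeometry.SemiGraphs.TemperedReconstructionFunctorialityProofs
import Literature.AnabelianGeometry.SemiGraphs.ProfiniteSemiGraphHomComp
import HarnessLib

/-!
# The conjugation action of `Π^tp_X` on `π₁^temp(𝒢^c)` is GRAPHIC at the finite special fibre:
# [SemiAnbd] Cor. 3.9 / Cor. 3.11 instantiated at `(𝒢^c, 𝒢^c, autOfConj g)` (proof-only)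

Mochizuki, *Semi-graphs of anabelioids*, Publ. RIMS **42** (2006), §3: Cor. 3.9 pp. 42–43 (graphicity of
quasi-geometric isomorphisms), Ex. 3.10 p. 44 ("semi-graphs of anabelioids `𝒢_i`, `𝒢^c_i` on which `Δ_i` acts"),
Cor. 3.11 proof pp. 46–47 (Cor. 3.9 at the graph `𝒢` WITHOUT compact structure, then the extension along the cusps)
[cite: MochizukiSemiAnbd2006, Cor 3.9 pp.42-43]; Mochizuki, *Inter-universal Teichmüller theory I*, §2 p. 47
l. 22–24 ("the natural action of `G_k` on `𝔾`") [cite: Mochizuki2012, IUTchI Cor 2.3(i) p.47]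
[claim: Mochizuki2012, status: disputed] (nothing of the IUT series is asserted here).

abc-iut cell, layer L3, BANKED row «COR39-INSTANCE-AUTOFCONJ» (L3-lead γ32 (3): way (b) of GAP-LEDGER
G-w4d052-g6-1 (P4-ii); F-1710 instance programme), seat abc-iut-L3-d1 gen 11.  PROOF-ONLY (no definition, no
instance, no notation, no `Prop` fact); every input BY NAME: abc-iut-L3-t2's `SpecialFibreData.autOfConj` /
`actVertex` dictionary (`TemperedSpecialFibreDataVertexAction`), abc-iut-w4-d083's Cor. 3.9-at-finite-pairs in
isomorphism form and the Cor. 3.11 cusp machinery (`SpecialFibreData.exists_isIso_graphCompatible_of_finite`,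
`graphCompatible_base_unique`, `exists_cuspExtension_of_cuspMatching`, `chartCompatible_base_maps_unique`,
`exists_isIso_chartCompatible_of_cuspExtensionUnique`), the functoriality `base_comp_of_compatV`, and the origin
record `SpecialFibreTower.PiData` (`actGraph₀_vertexMap`).

WHAT IS PROVED.  For special-fibre data `S` ([SemiAnbd] Ex. 3.10: `𝒢^c = S.Gc`, chart `π₁^temp(𝒢^c)`,
admissible quotient `Δ ↠ π₁^temp(𝒢^c)` whose kernel is normal in `Π`, binder `hK0`) with FINITE `𝒢^c`, and every
`g ∈ Π`, the automorphism `autOfConj g` of `π₁^temp(𝒢^c)` induced by conjugation by `g`: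
* A1 `exists_isIso_graphCompatible_autOfConj` — `autOfConj g` is compatible (on verticial AND edge homomorphisms,
  up to conjugation) with an ISOMORPHISM `F₀ : 𝒢 ⥲ 𝒢` of the cusp-omitted graph of anabelioids `𝒢 = S.graph` —
  Cor. 3.9 at the finite graph `𝒢`, a KERNEL THEOREM (Thm. 3.7 (iii)/(iv) at finite graphs are theorems of the
  tree); A2 its underlying morphism of semi-graphs is UNIQUE among locally open compatible `F₀`; A3 its vertex map
  IS the derived vertex action `S.actVertex g`; A4 the bases are MULTIPLICATIVE in `g` (functoriality of Cor. 3.9);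
  A5 for `δ ∈ Δ` the base is the IDENTITY (`autOfConj δ` is inner) — the graphic action factors through
  `Π/Δ = G_K`, print's "natural action of `G_K` on `𝔾`";
* B0–B3, with the cusps: modulo a CUSP MATCHING of `F₀` (abc-iut-w4-d083's `CuspMatching`; equivalently the
  Cor. 3.11 steps `CuspBranchesPreserved` / `CuspExtensionUnique` BY NAME at certified data, applied to
  `γ := conjDelta g`, `φ := autOfConj g`, which descends from `γ` by `autOfConj_admissible`) an ISOMORPHISM
  `F : 𝒢^c ⥲ 𝒢^c` of the semi-graph of anabelioids WITH compact structure, chart-compatible with `autOfConj g`,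
  extending `F₀`, with vertex map `actVertex g` and UNIQUE vertex/edge maps (cusps included);
* C1–C4, at the origin record `P : SpecialFibreTower.PiData X d S T` (its base fibre is finite, `P.finite`): the
  vertex part of the datum's graph action `P.actGraph₀ g` IS the vertex map of the Cor-3.9 isomorphism (C1/C2,
  for EVERY compatible locally open `F₀`), and with a cusp matching the chart-compatible `F : 𝒢^c ⥲ 𝒢^c` has
  `F.base.vertexMap = (P.actGraph₀ g).hom.vertexMap` (C3); two chart-compatible isomorphisms agree on all edge maps (C4).

HONEST RESIDUAL (for the consumers of the origin datum `PiData.ActGraphInduces`, p484597, displayed as `hind` in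
the [IUTchI] Cor. 2.3 headlines): that datum asks for `F.base = (P.actGraph₀ g).hom` INCLUDING the edge map and for
the chosen-conjugator functor isomorphism `F.Induces S.chart S.chart (autHom g)`.  This file DERIVES the vertex part
and the existence/uniqueness of a chart-compatible isomorphism of `𝒢^c`; what it does NOT derive is (a) the
agreement of the recorded `actGraph₀ g` with the derived isomorphism on EDGES (open edges = cusps are invisible to
`π₁^temp`, Rmk. 3.9.1; on nodes the derived edge map is unique but the record's is unconstrained) and (b) the
functor-level `Hom.Induces` for the CHOSEN conjugator family (the tree's (R3) `chartPullbackWith_iso_of_compatibleAt`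
gives `InducesUpToTwist` at the graph `𝒢`, which is Cor-3.9-hypotheses-shaped; `𝒢^c` with cusps is not a graph).
Nothing here is a claim about print beyond OUR finite carriers; no side is taken on [IUTchIII] Cor. 3.12; nothing
here asserts that abc is proved or refuted; typed ≠ proved for the by-name steps `CuspBranchesPreserved` /
`CuspExtensionUnique`.
-/

noncomputable section

namespace Literature.AnabelianGeometry.SemiGraphs

open CategoryTheory ProfiniteSemiGraph

universe u

namespace SpecialFibreData

variable {K : Type u} [Field K] {D : TemperedArithmeticGroup K} (S : SpecialFibreData D)

/-- A1. **`autOfConj g` is GRAPHIC on the cusp-omitted special fibre**: at finite `𝒢^c`, for every `g ∈ Π` there is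
an ISOMORPHISM `F₀ : 𝒢 ⥲ 𝒢` of the graph of anabelioids without compact structure compatible with `autOfConj g` on
verticial and edge homomorphisms up to conjugation (Cor. 3.9 at the finite graph `𝒢`, abc-iut-w4-d083's isomorphism
form, applied to `Sα = Sβ = S`). [cite: MochizukiSemiAnbd2006, Cor 3.9 p.42] -/
theorem exists_isIso_graphCompatible_autOfConj [Finite S.Gc.graph.Vertex] [Finite S.Gc.graph.Edge]
    (hK0 : (S.admissible.toMonoidHom.ker.map D.delta.subtype).Normal) (g : D.Pi) :
    ∃ F₀ : Hom S.graph S.graph, F₀.IsIso ∧ S.GraphCompatible S (S.autOfConj hK0 g) F₀ :=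
  S.exists_isIso_graphCompatible_of_finite S (S.autOfConj hK0 g)

/-- A2. **Uniqueness of the underlying morphism of semi-graphs** among locally open `F₀ : 𝒢 → 𝒢` compatible with
`autOfConj g` (Cor. 3.9 (b), uniqueness; unconditional). [cite: MochizukiSemiAnbd2006, Cor 3.9 p.43] -/
theorem graphCompatible_autOfConj_base_unique
    (hK0 : (S.admissible.toMonoidHom.ker.map D.delta.subtype).Normal) (g : D.Pi)
    {F₀ F₀' : Hom S.graph S.graph} (hF₀ : F₀.IsLocallyOpen) (hF₀' : F₀'.IsLocallyOpen)
    (h : S.GraphCompatible S (S.autOfConj hK0 g) F₀) (h' : S.GraphCompatible S (S.autOfConj hK0 g) F₀') :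
    F₀.base = F₀'.base :=
  S.graphCompatible_base_unique S (S.autOfConj hK0 g) hF₀ hF₀' h h'

/-- A3. **The vertex map of the Cor-3.9 isomorphism IS the derived vertex action `actVertex g`** (abc-iut-L3-t2's
dictionary `actVertex_apply_eq_iff`: `autOfConj g` carries the verticial subgroups at `v` onto those at `g · v`;
Thm. 3.7 (ii), (iv) at `𝒢^c`, binder `hiv`, a theorem at finite `𝒢^c`). [cite: MochizukiSemiAnbd2006, Thm 3.7(iv) p.41] -/
theorem graphCompatible_autOfConj_vertexMap
    (hK0 : (S.admissible.toMonoidHom.ker.map D.delta.subtype).Normal)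
    (hiv : MaximalCompactIffVerticialAt S.Gc) (g : D.Pi)
    {F₀ : Hom S.graph S.graph} (hF₀ : F₀.IsIso) (h : S.GraphCompatible S (S.autOfConj hK0 g) F₀)
    (v : S.graph.graph.Vertex) : (F₀.base.vertexMap v).1 = S.actVertex hK0 hiv g v.1 := by
  symm
  rw [actVertex_apply_eq_iff]
  rintro H ⟨ψ, hψ, rfl⟩
  obtain ⟨H', hH'⟩ := S.verticialSubgroups_nonempty (F₀.base.vertexMap v).1
  obtain ⟨ψ', hψ', rfl⟩ := hH'
  obtain ⟨c, hc⟩ := h.1 v ψ ψ' hψ hψ'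
  have hsurj : Function.Surjective (F₀.hV v) := (hF₀.isLocallyTrivial.1 v).2
  have heq : ψ.toMonoidHom.range.map (S.autOfConj hK0 g).toMonoidHom =
      ψ'.toMonoidHom.range.map (MulAut.conj c).toMonoidHom := by
    ext y
    constructor
    · rintro ⟨z, ⟨x, rfl⟩, rfl⟩
      refine ⟨ψ' (F₀.hV v x), ⟨F₀.hV v x, rfl⟩, ?_⟩
      change c * ψ' (F₀.hV v x) * c⁻¹ = S.autOfConj hK0 g (ψ x)
      exact (hc x).symm
    · rintro ⟨z, ⟨x', rfl⟩, rfl⟩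
      obtain ⟨x, rfl⟩ := hsurj x'
      refine ⟨ψ x, ⟨x, rfl⟩, ?_⟩
      change S.autOfConj hK0 g (ψ x) = c * ψ' (F₀.hV v x) * c⁻¹
      exact hc x
  rw [heq]
  exact conj_mem_verticialSubgroups S.chart ⟨ψ', hψ', rfl⟩ c

/-- The function `autOfConj (g * h)` is `autOfConj g ∘ autOfConj h` (as continuous homomorphisms).
[cite: MochizukiSemiAnbd2006, Ex 3.10 p.44] -/
theorem autOfConj_mul_eq_comp (hK0 : (S.admissible.toMonoidHom.ker.map D.delta.subtype).Normal) (g h : D.Pi) :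
    (S.autOfConj hK0 (g * h) : S.chart.G →ₜ* S.chart.G) =
      (S.autOfConj hK0 g : S.chart.G →ₜ* S.chart.G).comp (S.autOfConj hK0 h : S.chart.G →ₜ* S.chart.G) := by
  ext x
  exact S.autOfConj_mul hK0 g h x

/-- A4. **The Cor-3.9 bases are MULTIPLICATIVE in `g`**: if `F_g`, `F_h`, `F_{gh}` are locally open and
compatible with `autOfConj g`, `autOfConj h`, `autOfConj (g h)` on the cusp-omitted special fibre, then the
underlying morphism of semi-graphs of `F_{gh}` is the composite of those of `F_h` and `F_g` (functoriality of
Cor. 3.9, abc-iut-w4-d083's `base_comp_of_compatV`, UNCONDITIONAL). [cite: MochizukiSemiAnbd2006, Cor 3.9 pp.42-43] -/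
theorem graphCompatible_autOfConj_base_mul
    (hK0 : (S.admissible.toMonoidHom.ker.map D.delta.subtype).Normal) (g h : D.Pi)
    {Fg Fh Fgh : Hom S.graph S.graph} (hFg : Fg.IsLocallyOpen) (hFh : Fh.IsLocallyOpen)
    (hFgh : Fgh.IsLocallyOpen) (hg : S.GraphCompatible S (S.autOfConj hK0 g) Fg)
    (hh : S.GraphCompatible S (S.autOfConj hK0 h) Fh) (hgh : S.GraphCompatible S (S.autOfConj hK0 (g * h)) Fgh) :
    Fgh.base = Fh.base.comp Fg.base := by
  have hc := S.hyp.toProp36Hypotheses.maximalSubgraph_isCuspOmission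
  haveI := isEquivalence_btempRestrict hc
  let e := (S.Gc.btempRestrict S.Gc.graph.maximalSubgraph).asEquivalence
  let c : TemperedPiChart S.graph := S.chart.transport e.symm
  have hVg : Fg.CompatV c c (S.autOfConj hK0 g : S.chart.G →ₜ* S.chart.G) := fun v ψ ψ' hψ hψ' =>
    hg.1 v ψ ψ' hψ hψ'
  have hVh : Fh.CompatV c c (S.autOfConj hK0 h : S.chart.G →ₜ* S.chart.G) := fun v ψ ψ' hψ hψ' =>
    hh.1 v ψ ψ' hψ hψ'
  have hVgh : Fgh.CompatV c c
      ((S.autOfConj hK0 g : S.chart.G →ₜ* S.chart.G).comp (S.autOfConj hK0 h : S.chart.G →ₜ* S.chart.G)) :=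
    fun v ψ ψ' hψ hψ' => by
      obtain ⟨d, hd⟩ := hgh.1 v ψ ψ' hψ hψ'
      exact ⟨d, fun x => (S.autOfConj_mul hK0 g h (ψ x)).symm.trans (hd x)⟩
  exact base_comp_of_compatV S.cor39Hypotheses_graph S.cor39Hypotheses_graph S.cor39Hypotheses_graph c c c
    hFh hFg hFgh hVh hVg hVgh

/-- A5a. **For `δ ∈ Δ` the IDENTITY morphism of `𝒢` is compatible with `autOfConj δ`** (which is INNER:
conjugation by `admissible δ`, abc-iut-L3-t2's `autOfConj_coe`; two verticial / edge homomorphisms at the same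
vertex / edge are conjugate, Prop. 3.2). [cite: MochizukiSemiAnbd2006, Prop 3.2 p.35] -/
theorem graphCompatible_autOfConj_identity_of_mem_delta
    (hK0 : (S.admissible.toMonoidHom.ker.map D.delta.subtype).Normal) (δ : D.delta) :
    S.GraphCompatible S (S.autOfConj hK0 (δ : D.Pi)) (Hom.identity S.graph) := by
  refine ⟨fun v ψ ψ' hψ hψ' => ?_, fun e ψ ψ' hψ hψ' => ?_⟩
  · obtain ⟨c, hc⟩ := exists_conj_of_isVerticialHom S.chart ψ' ψ hψ' hψ
    refine ⟨S.admissible δ * c, fun x => ?_⟩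
    calc S.autOfConj hK0 (δ : D.Pi) (ψ x)
        = S.admissible δ * ψ x * (S.admissible δ)⁻¹ := S.autOfConj_coe hK0 δ _
      _ = S.admissible δ * (c * ψ' x * c⁻¹) * (S.admissible δ)⁻¹ :=
          congrArg (fun t => S.admissible δ * t * (S.admissible δ)⁻¹) (hc x).symm
      _ = S.admissible δ * c * ψ' x * (S.admissible δ * c)⁻¹ := by simp only [mul_inv_rev, mul_assoc]
  · obtain ⟨c, hc⟩ := exists_conj_of_isEdgeHom S.chart ψ' ψ hψ' hψ
    refine ⟨S.admissible δ * c, fun x => ?_⟩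
    calc S.autOfConj hK0 (δ : D.Pi) (ψ x)
        = S.admissible δ * ψ x * (S.admissible δ)⁻¹ := S.autOfConj_coe hK0 δ _
      _ = S.admissible δ * (c * ψ' x * c⁻¹) * (S.admissible δ)⁻¹ :=
          congrArg (fun t => S.admissible δ * t * (S.admissible δ)⁻¹) (hc x).symm
      _ = S.admissible δ * c * ψ' x * (S.admissible δ * c)⁻¹ := by simp only [mul_inv_rev, mul_assoc]

/-- A5b. **`Δ` acts TRIVIALLY on the cusp-omitted special fibre `𝒢`**: every locally open `F` compatible with
`autOfConj δ`, `δ ∈ Δ`, is the identity on the underlying semi-graph — so the graphic action of `Π` on `𝒢`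
factors through `Π/Δ = G_K` (print's "natural action of `G_K` on `𝔾`", [IUTchI] p. 47).
[cite: Mochizuki2012, IUTchI Cor 2.3(i) p.47] -/
theorem graphCompatible_autOfConj_base_eq_id_of_mem_delta
    (hK0 : (S.admissible.toMonoidHom.ker.map D.delta.subtype).Normal) (δ : D.delta)
    {F₀ : Hom S.graph S.graph} (hF₀ : F₀.IsLocallyOpen)
    (h : S.GraphCompatible S (S.autOfConj hK0 (δ : D.Pi)) F₀) : F₀.base = 𝟙 S.graph.graph :=
  S.graphCompatible_autOfConj_base_unique hK0 (δ : D.Pi) hF₀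
    (Hom.identity_isLocallyTrivial S.graph).isLocallyOpen h
    (S.graphCompatible_autOfConj_identity_of_mem_delta hK0 δ)


/-! ### B. With the cusps: the action on `𝒢^c` itself, modulo the cusp matching / step (C) of Cor. 3.11 BY NAME -/

/-- B0. **The vertex map of a chart-compatible isomorphism `F : 𝒢^c ⥲ 𝒢^c` for `autOfConj g` IS the derived
vertex action `actVertex g`** (Thm. 3.7 (ii), (iv) at `𝒢^c`). [cite: MochizukiSemiAnbd2006, Thm 3.7(iv) p.41] -/
theorem chartCompatible_autOfConj_vertexMap
    (hK0 : (S.admissible.toMonoidHom.ker.map D.delta.subtype).Normal)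
    (hiv : MaximalCompactIffVerticialAt S.Gc) (g : D.Pi)
    {F : Hom S.Gc S.Gc} (hF : F.IsIso) (h : S.ChartCompatible S (S.autOfConj hK0 g) F)
    (v : S.Gc.graph.Vertex) : F.base.vertexMap v = S.actVertex hK0 hiv g v := by
  symm
  rw [actVertex_apply_eq_iff]
  rintro H ⟨ψ, hψ, rfl⟩
  obtain ⟨H', hH'⟩ := S.verticialSubgroups_nonempty (F.base.vertexMap v)
  obtain ⟨ψ', hψ', rfl⟩ := hH'
  obtain ⟨c, hc⟩ := h v ψ ψ' hψ hψ'
  have hsurj : Function.Surjective (F.hV v) := (hF.isLocallyTrivial.1 v).2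
  have heq : ψ.toMonoidHom.range.map (S.autOfConj hK0 g).toMonoidHom =
      ψ'.toMonoidHom.range.map (MulAut.conj c).toMonoidHom := by
    ext y
    constructor
    · rintro ⟨z, ⟨x, rfl⟩, rfl⟩
      refine ⟨ψ' (F.hV v x), ⟨F.hV v x, rfl⟩, ?_⟩
      change c * ψ' (F.hV v x) * c⁻¹ = S.autOfConj hK0 g (ψ x)
      exact (hc x).symm
    · rintro ⟨z, ⟨x', rfl⟩, rfl⟩
      obtain ⟨x, rfl⟩ := hsurj x'
      refine ⟨ψ x, ⟨x, rfl⟩, ?_⟩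
      change S.autOfConj hK0 g (ψ x) = c * ψ' (F.hV v x) * c⁻¹
      exact hc x
  rw [heq]
  exact conj_mem_verticialSubgroups S.chart ⟨ψ', hψ', rfl⟩ c

/-- B1. **The conjugation action on `𝒢^c` as a semi-graph of anabelioids, from a CUSP MATCHING**: if the
Cor-3.9 isomorphism `F₀` of the cusp-omitted special fibre matches the cusps (abc-iut-w4-d083's `CuspMatching`,
the output of observations (i)–(iv) of the proof of Cor. 3.11), then `autOfConj g` is chart-compatible with an
ISOMORPHISM `F : 𝒢^c ⥲ 𝒢^c` extending `F₀`, whose vertex and edge maps (cusps included) are UNIQUE among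
chart-compatible isomorphisms. [cite: MochizukiSemiAnbd2006, Cor 3.11 pp.46-47] -/
theorem exists_isIso_chartCompatible_autOfConj_of_cuspMatching [Finite S.Gc.graph.Vertex]
    [Finite S.Gc.graph.Edge] (hK0 : (S.admissible.toMonoidHom.ker.map D.delta.subtype).Normal) (g : D.Pi)
    (hm : ∀ F₀ : Hom S.graph S.graph, F₀.IsIso → S.GraphCompatible S (S.autOfConj hK0 g) F₀ →
      S.CuspMatching S F₀) :
    ∃ (F₀ : Hom S.graph S.graph) (F : Hom S.Gc S.Gc), F₀.IsIso ∧ S.GraphCompatible S (S.autOfConj hK0 g) F₀ ∧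
      F.IsIso ∧ F.ExtendsBase F₀ ∧ S.ChartCompatible S (S.autOfConj hK0 g) F ∧
      ∀ F' : Hom S.Gc S.Gc, F'.IsIso → S.ChartCompatible S (S.autOfConj hK0 g) F' →
        F'.base.vertexMap = F.base.vertexMap ∧ F'.base.edgeMap = F.base.edgeMap := by
  obtain ⟨F₀, hF₀, hc⟩ := S.exists_isIso_graphCompatible_autOfConj hK0 g
  obtain ⟨F, hF, hext, hcF⟩ :=
    S.exists_cuspExtension_of_cuspMatching S (S.autOfConj hK0 g) F₀ hF₀ hc (hm F₀ hF₀ hc)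
  exact ⟨F₀, F, hF₀, hc, hF, hext, hcF, fun F' hF' hc' => S.chartCompatible_base_maps_unique S _ hF hF' hcF hc'⟩

/-- B2. **The same at CERTIFIED special-fibre data, from the cusp-matching step `CuspBranchesPreserved` BY NAME**
(print's (ii)–(iv) of the proof of Cor. 3.11), applied to `γ := conjDelta g` (conjugation by `g` on `Δ`) and
`φ := autOfConj g`, which descends from `γ` along the admissible quotient (`autOfConj_admissible`).
[cite: MochizukiSemiAnbd2006, Cor 3.11 pp.46-47] -/
theorem exists_isIso_chartCompatible_autOfConj_of_cuspBranchesPreserved (Ω : SpecialFibreOrigin K)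
    (hCB : CuspBranchesPreserved Ω Ω) (hS : Ω.IsSpecialFibreOf D S) [Finite S.Gc.graph.Vertex]
    [Finite S.Gc.graph.Edge] (hK0 : (S.admissible.toMonoidHom.ker.map D.delta.subtype).Normal) (g : D.Pi) :
    ∃ (F₀ : Hom S.graph S.graph) (F : Hom S.Gc S.Gc), F₀.IsIso ∧ S.GraphCompatible S (S.autOfConj hK0 g) F₀ ∧
      F.IsIso ∧ F.ExtendsBase F₀ ∧ S.ChartCompatible S (S.autOfConj hK0 g) F ∧
      ∀ F' : Hom S.Gc S.Gc, F'.IsIso → S.ChartCompatible S (S.autOfConj hK0 g) F' →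
        F'.base.vertexMap = F.base.vertexMap ∧ F'.base.edgeMap = F.base.edgeMap :=
  S.exists_isIso_chartCompatible_autOfConj_of_cuspMatching hK0 g fun F₀ hF₀ hc =>
    hCB D D S S hS hS (conjDelta g) (S.autOfConj hK0 g) (S.autOfConj_admissible hK0 g) F₀ hF₀ hc

/-- B3. **The same from step (C) of Cor. 3.11 as typed (`CuspExtensionUnique`) BY NAME.**
[cite: MochizukiSemiAnbd2006, Cor 3.11 pp.46-47] -/
theorem exists_isIso_chartCompatible_autOfConj_of_cuspExtensionUnique (Ω : SpecialFibreOrigin K)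
    (hC : CuspExtensionUnique Ω Ω) (hS : Ω.IsSpecialFibreOf D S) [Finite S.Gc.graph.Vertex]
    [Finite S.Gc.graph.Edge] (hK0 : (S.admissible.toMonoidHom.ker.map D.delta.subtype).Normal) (g : D.Pi) :
    ∃ F : Hom S.Gc S.Gc, F.IsIso ∧ S.ChartCompatible S (S.autOfConj hK0 g) F ∧
      ∀ F' : Hom S.Gc S.Gc, F'.IsIso → S.ChartCompatible S (S.autOfConj hK0 g) F' →
        F'.base.vertexMap = F.base.vertexMap ∧ F'.base.edgeMap = F.base.edgeMap := by
  obtain ⟨F, hF, hcF⟩ := exists_isIso_chartCompatible_of_cuspExtensionUnique Ω Ω hC D D S S hS hS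
    (conjDelta g) (S.autOfConj hK0 g) (S.autOfConj_admissible hK0 g)
  exact ⟨F, hF, hcF, fun F' hF' hc' => S.chartCompatible_base_maps_unique S _ hF hF' hcF hc'⟩

end SpecialFibreData

/-! ### C. At the origin record `SpecialFibreTower.PiData`: the vertex part of the datum's graph action is DERIVED -/

namespace SpecialFibreTower

namespace PiData

open SpecialFibreData

variable {p : ℕ} [Fact p.Prime] {X : TemperedCurve p} {d : X.GroupLevelData}
  {S : SpecialFibreData (X.toTemperedArithmeticGroup d)} {T : SpecialFibreTower X.DeltaTemp}

/-- The base special fibre of a `PiData` is finite (vertices). [cite: MochizukiSemiAnbd2006, Ex 3.10 p.44] -/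
theorem finite_vertex (P : PiData X d S T) : Finite S.Gc.graph.Vertex := P.finite.finite_vertex_base

/-- The base special fibre of a `PiData` is finite (edges). [cite: MochizukiSemiAnbd2006, Ex 3.10 p.44] -/
theorem finite_edge (P : PiData X d S T) : Finite S.Gc.graph.Edge := P.finite.finite_edge_base

/-- C1. **At the genuine 𝔛-datum, `autOfConj g` is graphic on the cusp-omitted special fibre, and the vertex
part of the Cor-3.9 isomorphism IS the datum's `actGraph₀ g` on vertices** (`actGraph₀_vertexMap` + A3; Thm. 3.7
(iv) at the finite `𝒢^c` is a theorem). [cite: Mochizuki2012, IUTchI Cor 2.3(i) p.47] -/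
theorem exists_isIso_graphCompatible_autOfConj (P : PiData X d S T) (g : X.PiTemp) :
    ∃ F₀ : Hom S.graph S.graph, F₀.IsIso ∧ S.GraphCompatible S (S.autOfConj P.admissibleKer_normal_pi g) F₀ ∧
      ∀ v : S.graph.graph.Vertex, (F₀.base.vertexMap v).1 = (P.actGraph₀ g).hom.vertexMap v.1 := by
  haveI := P.finite_vertex; haveI := P.finite_edge
  obtain ⟨F₀, hF₀, hc⟩ := S.exists_isIso_graphCompatible_autOfConj P.admissibleKer_normal_pi g
  refine ⟨F₀, hF₀, hc, fun v => ?_⟩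
  rw [P.actGraph₀_vertexMap maximalCompactIffVerticialAt_of_finiteGraph g v.1]
  exact S.graphCompatible_autOfConj_vertexMap _ _ g hF₀ hc v

/-- C2. **Uniqueness**: ANY locally open `F₀ : 𝒢 → 𝒢` compatible with `autOfConj g` has the vertex map of
`actGraph₀ g` (so the datum's vertex action is forced by Cor. 3.9, independently of the recorded `actGraph₀`).
[cite: MochizukiSemiAnbd2006, Cor 3.9 p.43] -/
theorem vertexMap_eq_actGraph₀_of_graphCompatible (P : PiData X d S T) (g : X.PiTemp)
    {F₀ : Hom S.graph S.graph} (hF₀ : F₀.IsLocallyOpen)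
    (h : S.GraphCompatible S (S.autOfConj P.admissibleKer_normal_pi g) F₀) (v : S.graph.graph.Vertex) :
    (F₀.base.vertexMap v).1 = (P.actGraph₀ g).hom.vertexMap v.1 := by
  obtain ⟨F₁, hF₁, hc₁, hv⟩ := P.exists_isIso_graphCompatible_autOfConj g
  rw [← hv v, S.graphCompatible_autOfConj_base_unique P.admissibleKer_normal_pi g hF₀
    hF₁.isLocallyTrivial.isLocallyOpen h hc₁]

/-- C3. **With the cusps, from a cusp matching**: an isomorphism `F : 𝒢^c ⥲ 𝒢^c` of the semi-graph of
anabelioids WITH compact structure, chart-compatible with `autOfConj g`, whose vertex map IS `actGraph₀ g` on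
vertices and whose vertex/edge maps are unique — the origin datum `ActGraphInduces` (p484597) is thereby DERIVED
on vertices and on nodes; its residual content is the labelling of the cusps by `actGraph₀ g` and the
chosen-conjugator functor isomorphism `Hom.Induces`. [cite: Mochizuki2012, IUTchI Cor 2.3(i) p.47] -/
theorem exists_isIso_chartCompatible_autOfConj_of_cuspMatching (P : PiData X d S T) (g : X.PiTemp)
    (hm : ∀ F₀ : Hom S.graph S.graph, F₀.IsIso →
      S.GraphCompatible S (S.autOfConj P.admissibleKer_normal_pi g) F₀ → S.CuspMatching S F₀) :
    ∃ F : Hom S.Gc S.Gc, F.IsIso ∧ S.ChartCompatible S (S.autOfConj P.admissibleKer_normal_pi g) F ∧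
      F.base.vertexMap = (P.actGraph₀ g).hom.vertexMap ∧
      ∀ F' : Hom S.Gc S.Gc, F'.IsIso → S.ChartCompatible S (S.autOfConj P.admissibleKer_normal_pi g) F' →
        F'.base.vertexMap = F.base.vertexMap ∧ F'.base.edgeMap = F.base.edgeMap := by
  haveI := P.finite_vertex; haveI := P.finite_edge
  obtain ⟨-, F, -, -, hF, -, hcF, huniq⟩ :=
    S.exists_isIso_chartCompatible_autOfConj_of_cuspMatching P.admissibleKer_normal_pi g hm
  refine ⟨F, hF, hcF, funext fun v => ?_, huniq⟩
  rw [P.actGraph₀_vertexMap maximalCompactIffVerticialAt_of_finiteGraph g v]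
  exact S.chartCompatible_autOfConj_vertexMap _ _ g hF hcF v

/-- C4. **Consistency of the datum**: every `F` witnessing `ActGraphInduces` at `g` that is chart-compatible
with `autOfConj g` has the same vertex and edge maps as the Cor-3.9/(C) isomorphism of C3 (uniqueness) — the
recorded action and the derived one cannot disagree on closed or open edges once both are chart-compatible.
[cite: MochizukiSemiAnbd2006, Cor 3.11 p.47] -/
theorem base_maps_eq_of_chartCompatible (P : PiData X d S T) (g : X.PiTemp) {F F' : Hom S.Gc S.Gc}
    (hF : F.IsIso) (hF' : F'.IsIso) (h : S.ChartCompatible S (S.autOfConj P.admissibleKer_normal_pi g) F)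
    (h' : S.ChartCompatible S (S.autOfConj P.admissibleKer_normal_pi g) F') :
    F'.base.vertexMap = F.base.vertexMap ∧ F'.base.edgeMap = F.base.edgeMap :=
  S.chartCompatible_base_maps_unique S _ hF hF' h h'

end PiData

end SpecialFibreTower

end Literature.AnabelianGeometry.SemiGraphs

end

/-! ## v2 (append-only) — D. The same in Cor. 3.11 currency: `Cor311Compatible S S (conjDelta g)` self-isomorphisms

Junction (β′) of the [SemiAnbd] Thm 6.5 (iii) / FACT-LIST F-1704 lane (L3-lead β61 bank; abc-iut-L3-d2's
`cor311_base_equivariant` / `cor311_base_equivariant_of_autAction`, `TemperedSpecialFibreCor311Equivariance(Aut).lean`,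
take as INPUT self-isomorphisms `A : 𝒢^c ⥲ 𝒢^c` that are `Cor311Compatible` over `σ = conjDelta g`): a chart-compatible
isomorphism for `autOfConj g` IS such an `A` (the descended isomorphism being `autOfConj g`, `autOfConj_admissible`), and
conversely; hence, at FINITE special fibres and modulo the cusp matching / the Cor. 3.11 cusp step BY NAME, such `A`
EXIST, with vertex map `actVertex g` (= the datum's `actGraph₀ g` on vertices at a `PiData`) and unique vertex/edge maps.
What stays a datum for `cor311_base_equivariant_of_autAction`'s hypothesis `A.base = (AX g).hom`: the EDGE part of the
recorded action. [cite: MochizukiSemiAnbd2006, Cor 3.11 pp.45-46]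
-/

namespace Literature.AnabelianGeometry.SemiGraphs

namespace SpecialFibreData

open ProfiniteSemiGraph

universe v

variable {K : Type v} [Field K] {D : TemperedArithmeticGroup K} (S : SpecialFibreData D)

/-- D1. A chart-compatible `F : 𝒢^c → 𝒢^c` for `autOfConj g` is Cor-3.11-compatible over `conjDelta g` (the
descended isomorphism is `autOfConj g`: `autOfConj_admissible`). [cite: MochizukiSemiAnbd2006, Cor 3.11 p.46] -/
theorem cor311Compatible_conjDelta_of_chartCompatible
    (hK0 : (S.admissible.toMonoidHom.ker.map D.delta.subtype).Normal) (g : D.Pi) {F : Hom S.Gc S.Gc}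
    (h : S.ChartCompatible S (S.autOfConj hK0 g) F) : Cor311Compatible S S (conjDelta g) F :=
  ⟨S.autOfConj hK0 g, S.autOfConj_admissible hK0 g, h⟩

/-- D2. Conversely, a Cor-3.11-compatible `F` over `conjDelta g` is chart-compatible with `autOfConj g`: the
isomorphism `φ` descending `conjDelta g` along the SURJECTIVE admissible quotient is `autOfConj g`.
[cite: MochizukiSemiAnbd2006, Cor 3.11 p.46] -/
theorem chartCompatible_of_cor311Compatible_conjDelta
    (hK0 : (S.admissible.toMonoidHom.ker.map D.delta.subtype).Normal) (g : D.Pi) {F : Hom S.Gc S.Gc}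
    (h : Cor311Compatible S S (conjDelta g) F) : S.ChartCompatible S (S.autOfConj hK0 g) F := by
  obtain ⟨φ, hφ, hc⟩ := h
  have heq : ∀ y, φ y = S.autOfConj hK0 g y := fun y => by
    obtain ⟨x, rfl⟩ := S.admissible_surjective y
    rw [hφ, autOfConj_admissible]
  intro v ψα ψβ hα hβ
  obtain ⟨c, hc'⟩ := hc v ψα ψβ hα hβ
  exact ⟨c, fun x => (heq _).symm.trans (hc' x)⟩

/-- D3. **Uniqueness**: two Cor-3.11-compatible ISOMORPHISMS `𝒢^c ⥲ 𝒢^c` over `conjDelta g` have the same vertex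
and edge maps (cusps included). [cite: MochizukiSemiAnbd2006, Cor 3.11 p.47] -/
theorem cor311Compatible_conjDelta_base_maps_unique
    (hK0 : (S.admissible.toMonoidHom.ker.map D.delta.subtype).Normal) (g : D.Pi) {A A' : Hom S.Gc S.Gc}
    (hA : A.IsIso) (hA' : A'.IsIso) (h : Cor311Compatible S S (conjDelta g) A)
    (h' : Cor311Compatible S S (conjDelta g) A') :
    A'.base.vertexMap = A.base.vertexMap ∧ A'.base.edgeMap = A.base.edgeMap :=
  S.chartCompatible_base_maps_unique S (S.autOfConj hK0 g) hA hA'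
    (S.chartCompatible_of_cor311Compatible_conjDelta hK0 g h) (S.chartCompatible_of_cor311Compatible_conjDelta hK0 g h')

/-- D4. **The vertex map of a Cor-3.11-compatible isomorphism over `conjDelta g` IS `actVertex g`.**
[cite: MochizukiSemiAnbd2006, Thm 3.7(iv) p.41] -/
theorem cor311Compatible_conjDelta_vertexMap
    (hK0 : (S.admissible.toMonoidHom.ker.map D.delta.subtype).Normal)
    (hiv : MaximalCompactIffVerticialAt S.Gc) (g : D.Pi) {A : Hom S.Gc S.Gc} (hA : A.IsIso)
    (h : Cor311Compatible S S (conjDelta g) A) (v : S.Gc.graph.Vertex) :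
    A.base.vertexMap v = S.actVertex hK0 hiv g v :=
  S.chartCompatible_autOfConj_vertexMap hK0 hiv g hA (S.chartCompatible_of_cor311Compatible_conjDelta hK0 g h) v

/-- D5. **(β′) at FINITE special fibres from a cusp matching**: a Cor-3.11-compatible ISOMORPHISM `A : 𝒢^c ⥲ 𝒢^c`
over `conjDelta g` EXISTS, its vertex map is `actVertex g`, and its vertex/edge maps are unique — exactly the input
shape of abc-iut-L3-d2's `cor311_base_equivariant`. [cite: MochizukiSemiAnbd2006, Cor 3.11 pp.46-47] -/
theorem exists_isIso_cor311Compatible_conjDelta_of_cuspMatching [Finite S.Gc.graph.Vertex]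
    [Finite S.Gc.graph.Edge] (hK0 : (S.admissible.toMonoidHom.ker.map D.delta.subtype).Normal) (g : D.Pi)
    (hm : ∀ F₀ : Hom S.graph S.graph, F₀.IsIso → S.GraphCompatible S (S.autOfConj hK0 g) F₀ →
      S.CuspMatching S F₀) :
    ∃ A : Hom S.Gc S.Gc, A.IsIso ∧ Cor311Compatible S S (conjDelta g) A ∧
      (∀ v, A.base.vertexMap v = S.actVertex hK0 maximalCompactIffVerticialAt_of_finiteGraph g v) ∧
      ∀ A' : Hom S.Gc S.Gc, A'.IsIso → Cor311Compatible S S (conjDelta g) A' →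
        A'.base.vertexMap = A.base.vertexMap ∧ A'.base.edgeMap = A.base.edgeMap := by
  obtain ⟨-, A, -, -, hA, -, hcA, -⟩ := S.exists_isIso_chartCompatible_autOfConj_of_cuspMatching hK0 g hm
  exact ⟨A, hA, S.cor311Compatible_conjDelta_of_chartCompatible hK0 g hcA,
    fun v => S.chartCompatible_autOfConj_vertexMap hK0 _ g hA hcA v,
    fun A' hA' h' => S.cor311Compatible_conjDelta_base_maps_unique hK0 g hA hA'
      (S.cor311Compatible_conjDelta_of_chartCompatible hK0 g hcA) h'⟩

/-- D6. **(β′) at CERTIFIED finite special fibres from `CuspBranchesPreserved` BY NAME.**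
[cite: MochizukiSemiAnbd2006, Cor 3.11 pp.46-47] -/
theorem exists_isIso_cor311Compatible_conjDelta_of_cuspBranchesPreserved (Ω : SpecialFibreOrigin K)
    (hCB : CuspBranchesPreserved Ω Ω) (hS : Ω.IsSpecialFibreOf D S) [Finite S.Gc.graph.Vertex]
    [Finite S.Gc.graph.Edge] (hK0 : (S.admissible.toMonoidHom.ker.map D.delta.subtype).Normal) (g : D.Pi) :
    ∃ A : Hom S.Gc S.Gc, A.IsIso ∧ Cor311Compatible S S (conjDelta g) A ∧
      (∀ v, A.base.vertexMap v = S.actVertex hK0 maximalCompactIffVerticialAt_of_finiteGraph g v) ∧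
      ∀ A' : Hom S.Gc S.Gc, A'.IsIso → Cor311Compatible S S (conjDelta g) A' →
        A'.base.vertexMap = A.base.vertexMap ∧ A'.base.edgeMap = A.base.edgeMap :=
  S.exists_isIso_cor311Compatible_conjDelta_of_cuspMatching hK0 g fun F₀ hF₀ hc =>
    hCB D D S S hS hS (conjDelta g) (S.autOfConj hK0 g) (S.autOfConj_admissible hK0 g) F₀ hF₀ hc

/-- D7. **(β′) at CERTIFIED finite special fibres from step (C) `CuspExtensionUnique` BY NAME.**
[cite: MochizukiSemiAnbd2006, Cor 3.11 pp.46-47] -/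
theorem exists_isIso_cor311Compatible_conjDelta_of_cuspExtensionUnique (Ω : SpecialFibreOrigin K)
    (hC : CuspExtensionUnique Ω Ω) (hS : Ω.IsSpecialFibreOf D S) [Finite S.Gc.graph.Vertex]
    [Finite S.Gc.graph.Edge] (hK0 : (S.admissible.toMonoidHom.ker.map D.delta.subtype).Normal) (g : D.Pi) :
    ∃ A : Hom S.Gc S.Gc, A.IsIso ∧ Cor311Compatible S S (conjDelta g) A ∧
      (∀ v, A.base.vertexMap v = S.actVertex hK0 maximalCompactIffVerticialAt_of_finiteGraph g v) ∧
      ∀ A' : Hom S.Gc S.Gc, A'.IsIso → Cor311Compatible S S (conjDelta g) A' →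
        A'.base.vertexMap = A.base.vertexMap ∧ A'.base.edgeMap = A.base.edgeMap := by
  obtain ⟨A, hA, hcA, -⟩ := S.exists_isIso_chartCompatible_autOfConj_of_cuspExtensionUnique Ω hC hS hK0 g
  exact ⟨A, hA, S.cor311Compatible_conjDelta_of_chartCompatible hK0 g hcA,
    fun v => S.chartCompatible_autOfConj_vertexMap hK0 _ g hA hcA v,
    fun A' hA' h' => S.cor311Compatible_conjDelta_base_maps_unique hK0 g hA hA'
      (S.cor311Compatible_conjDelta_of_chartCompatible hK0 g hcA) h'⟩

end SpecialFibreData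

namespace SpecialFibreTower

namespace PiData

open ProfiniteSemiGraph SpecialFibreData

variable {p : ℕ} [Fact p.Prime] {X : TemperedCurve p} {d : X.GroupLevelData}
  {S : SpecialFibreData (X.toTemperedArithmeticGroup d)} {T : SpecialFibreTower X.DeltaTemp}

/-- D8. **(β′) at the origin record, base fibre**: modulo a cusp matching, for every `g ∈ Π^tp_X` a
Cor-3.11-compatible self-isomorphism `A_g : 𝒢^c ⥲ 𝒢^c` over `conjDelta g` whose vertex map IS the datum's
`actGraph₀ g` on vertices; unique vertex/edge maps.  (The hypothesis `A.base = (P.actGraph₀ g).hom` of abc-iut-L3-d2's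
`cor311_base_equivariant_of_autAction` is thereby met on VERTICES; its edge part stays a datum.)
[cite: Mochizuki2012, IUTchI Cor 2.3(i) p.47] -/
theorem exists_isIso_cor311Compatible_conjDelta_of_cuspMatching (P : PiData X d S T) (g : X.PiTemp)
    (hm : ∀ F₀ : Hom S.graph S.graph, F₀.IsIso →
      S.GraphCompatible S (S.autOfConj P.admissibleKer_normal_pi g) F₀ → S.CuspMatching S F₀) :
    ∃ A : Hom S.Gc S.Gc, A.IsIso ∧ Cor311Compatible S S (conjDelta g) A ∧
      A.base.vertexMap = (P.actGraph₀ g).hom.vertexMap ∧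
      ∀ A' : Hom S.Gc S.Gc, A'.IsIso → Cor311Compatible S S (conjDelta g) A' →
        A'.base.vertexMap = A.base.vertexMap ∧ A'.base.edgeMap = A.base.edgeMap := by
  haveI := P.finite_vertex; haveI := P.finite_edge
  obtain ⟨A, hA, hcA, hv, huniq⟩ := P.exists_isIso_chartCompatible_autOfConj_of_cuspMatching g hm
  exact ⟨A, hA, S.cor311Compatible_conjDelta_of_chartCompatible _ g hcA, hv, fun A' hA' h' =>
    huniq A' hA' (S.chartCompatible_of_cor311Compatible_conjDelta _ g h')⟩

end PiData

end SpecialFibreTower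

end Literature.AnabelianGeometry.SemiGraphs
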